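import Mathlib.FieldTheory.KummerExtension
import Mathlib.FieldTheory.Galois.Basic
import Mathlib.FieldTheory.IntermediateField.Adjoin.Algebra
import Literature.FieldTheory.Kummer.KummerIrreducible
import HarnessLib

/-!
# Kummer theory of finite rank: the exponent representation of the Galois group

For a field `L` containing a primitive `n`-th root of unity `ζ` and elements `y₁, …, y_k` of an
extension `Ω` with `yᵢⁿ = cᵢ ∈ Lˣ`, the field `E = L(y₁, …, y_k)` is normal over `L` and every
`L`-automorphism `σ` of `E` acts on the generators by roots of unity: `σ(yᵢ) = ζ^{aᵢ(σ)} yᵢ`.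
This file sets up the resulting injective group homomorphism
`Gal(E/L) → (ℤ/n)ᵏ`, `σ ↦ (aᵢ(σ))ᵢ` (Lang, *Algebra*, VI §8, proof of Thm 8.1/8.2), the first
step of Kummer theory of finite rank (used for Bays–Kirby 2018, Prop. 3.22: good bases).

* `Literature.FieldTheory.Kummer.exists_expnt` — `σ(yᵢ)/yᵢ` is a power of `ζ`;
* `Literature.FieldTheory.Kummer.expnt`, `Literature.FieldTheory.Kummer.algEquiv_apply_gen` — the exponents `aᵢ(σ) ∈ ZMod n` with
  `σ(yᵢ) = ζ^{aᵢ(σ)} yᵢ`;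
* `Literature.FieldTheory.Kummer.expnt_mul` — `a(στ) = a(σ) + a(τ)`;
* `Literature.FieldTheory.Kummer.expntHom`, `Literature.FieldTheory.Kummer.expntHom_injective` — the injective homomorphism
  `Gal(E/L) →* Multiplicative (Fin k → ZMod n)`.

## References

* S. Lang, *Algebra*, 3rd ed., GTM 211, Springer 2002, Ch. VI §8 (Thm 8.1, Thm 8.2).
-/

noncomputable section

open Polynomial IntermediateField

namespace Literature.FieldTheory.Kummer

variable {L Ω : Type*} [Field L] [Field Ω] [Algebra L Ω]
variable {n k : ℕ} [NeZero n] {ζ : L} (hζ : IsPrimitiveRoot ζ n)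
variable (y : Fin k → Ω) (c : Fin k → L) (hc : ∀ i, c i ≠ 0)
  (hy : ∀ i, y i ^ n = algebraMap L Ω (c i))

variable (L) in
/-- The Kummer field `E = L(y₁, …, y_k) ⊆ Ω`. [cite: Lang2002, VI §8] -/
abbrev kummerField : IntermediateField L Ω := IntermediateField.adjoin L (Set.range y)

include hc hy in
omit [NeZero n] in
/-- The generators are non-zero. [folklore] -/
theorem gen_ne_zero (hn : 0 < n) (i : Fin k) : y i ≠ 0 := by
  intro h
  have := hy i
  rw [h, zero_pow hn.ne'] at this
  exact hc i ((map_eq_zero_iff _ (algebraMap L Ω).injective).1 this.symm)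

variable (L) in
/-- The generator `yᵢ` as an element of `E`. [folklore] -/
def gen (i : Fin k) : kummerField L y :=
  ⟨y i, IntermediateField.subset_adjoin L _ ⟨i, rfl⟩⟩

omit [NeZero n] in
/-- Coercion of the generator. [folklore] -/
@[simp] theorem coe_gen (i : Fin k) : (gen L y i : Ω) = y i := rfl

include hζ hc hy in
/-- **Automorphisms act on the generators by roots of unity**: for `σ ∈ Gal(E/L)`,
`σ(yᵢ) = ζ^a yᵢ` for some `a < n` (`(σ(yᵢ)/yᵢ)ⁿ = σ(cᵢ)/cᵢ = 1` and every `n`-th root of unity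
of `Ω` is a power of the primitive root `ζ ∈ L`). [cite: Lang2002, VI §8 (proof of Thm 8.1)] -/
theorem exists_expnt (σ : kummerField L y ≃ₐ[L] kummerField L y) (i : Fin k) :
    ∃ a : ℕ, a < n ∧ (σ (gen L y i) : Ω) = algebraMap L Ω ζ ^ a * y i := by
  have hn : 0 < n := Nat.pos_of_ne_zero (NeZero.ne n)
  have hyi : y i ≠ 0 := gen_ne_zero y c hc hy hn i
  -- `(σ yᵢ)ⁿ = cᵢ`
  have h1 : ((σ (gen L y i) : kummerField L y) : Ω) ^ n = algebraMap L Ω (c i) := by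
    have : (gen L y i) ^ n = algebraMap L (kummerField L y) (c i) := by
      apply Subtype.ext
      simp only [SubmonoidClass.coe_pow, coe_gen, hy i]
      rfl
    rw [← SubmonoidClass.coe_pow, ← map_pow, this, AlgEquiv.commutes]
    rfl
  -- so `σ yᵢ / yᵢ` is an `n`-th root of unity, a power of `ζ`
  set ξ : Ω := (σ (gen L y i) : Ω) * (y i)⁻¹ with hξ
  have hξn : ξ ^ n = 1 := by
    rw [hξ, mul_pow, h1, ← hy i, inv_pow, mul_inv_cancel₀ (pow_ne_zero _ hyi)]
  have hζ' : IsPrimitiveRoot (algebraMap L Ω ζ) n := hζ.map_of_injective (algebraMap L Ω).injective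
  obtain ⟨a, ha, haξ⟩ := hζ'.eq_pow_of_pow_eq_one hξn
  refine ⟨a, ha, ?_⟩
  rw [haξ, hξ, inv_mul_cancel_right₀ hyi]

/-- **The exponent `aᵢ(σ) ∈ ℤ/n`** with `σ(yᵢ) = ζ^{aᵢ(σ)} yᵢ`. [cite: Lang2002, VI §8] -/
def expnt (σ : kummerField L y ≃ₐ[L] kummerField L y) (i : Fin k) : ZMod n :=
  ((exists_expnt hζ y c hc hy σ i).choose : ZMod n)

/-- `ζ^a` for `a ∈ ℤ/n` is well defined (`ζⁿ = 1`): we use `ζ ^ a.val`. The defining property of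
`expnt`: `σ(yᵢ) = ζ^{aᵢ(σ)} yᵢ`. [cite: Lang2002, VI §8] -/
theorem algEquiv_apply_gen (σ : kummerField L y ≃ₐ[L] kummerField L y) (i : Fin k) :
    (σ (gen L y i) : Ω) = algebraMap L Ω ζ ^ (expnt hζ y c hc hy σ i).val * y i := by
  have h := (exists_expnt hζ y c hc hy σ i).choose_spec
  rw [expnt, ZMod.val_natCast_of_lt h.1]
  exact h.2

include hζ in
omit [NeZero n] in
/-- Powers of `ζ` only depend on the exponent modulo `n`. [folklore] -/
theorem zeta_pow_eq_pow_of_modEq {a b : ℕ} (h : a ≡ b [MOD n]) :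
    algebraMap L Ω ζ ^ a = algebraMap L Ω ζ ^ b := by
  have h1 : algebraMap L Ω ζ ^ n = 1 := by rw [← map_pow, hζ.pow_eq_one, map_one]
  rw [pow_eq_pow_mod a h1, pow_eq_pow_mod b h1, h]

include hζ in
/-- `ζ ^ (a + b).val = ζ ^ a.val * ζ ^ b.val` in `ZMod n` exponents. [folklore] -/
theorem zeta_pow_val_add (a b : ZMod n) :
    algebraMap L Ω ζ ^ (a + b).val = algebraMap L Ω ζ ^ a.val * algebraMap L Ω ζ ^ b.val := by
  rw [← pow_add]
  apply zeta_pow_eq_pow_of_modEq hζ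
  rw [Nat.ModEq, ZMod.val_add]
  exact Nat.mod_modEq _ _

/-- **Multiplicativity of the exponents**: `a(στ) = a(σ) + a(τ)` (as `σ` fixes `ζ ∈ L`).
[cite: Lang2002, VI §8 (proof of Thm 8.1)] -/
theorem expnt_mul (σ τ : kummerField L y ≃ₐ[L] kummerField L y) (i : Fin k) :
    expnt hζ y c hc hy (σ * τ) i = expnt hζ y c hc hy σ i + expnt hζ y c hc hy τ i := by
  have hn : 0 < n := Nat.pos_of_ne_zero (NeZero.ne n)
  have hyi : y i ≠ 0 := gen_ne_zero y c hc hy hn i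
  have hζ' : IsPrimitiveRoot (algebraMap L Ω ζ) n := hζ.map_of_injective (algebraMap L Ω).injective
  -- compute `(στ)(yᵢ)` in two ways
  have h1 := algEquiv_apply_gen hζ y c hc hy (σ * τ) i
  have h2 : ((σ * τ) (gen L y i) : Ω) =
      algebraMap L Ω ζ ^ (expnt hζ y c hc hy σ i).val *
        (algebraMap L Ω ζ ^ (expnt hζ y c hc hy τ i).val * y i) := by
    rw [AlgEquiv.mul_apply]
    -- `τ (gen i) = ζ^{a τ} • gen i` inside `E`
    have hτ : τ (gen L y i) = algebraMap L (kummerField L y) (ζ ^ (expnt hζ y c hc hy τ i).val) * gen L y i := by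
      apply Subtype.ext
      rw [MulMemClass.coe_mul, algEquiv_apply_gen hζ y c hc hy τ i, map_pow]
      rfl
    rw [hτ, map_mul, AlgEquiv.commutes, MulMemClass.coe_mul, algEquiv_apply_gen hζ y c hc hy σ i,
      map_pow]
    change (algebraMap L Ω ζ) ^ _ * _ = _
    ring
  rw [h1, ← mul_assoc, ← zeta_pow_val_add hζ] at h2
  have h3 := mul_right_cancel₀ hyi h2
  -- equal powers of a primitive root with exponents `< n`: exponents agree
  have h4 := hζ'.pow_inj (ZMod.val_lt _) (ZMod.val_lt _) h3
  exact ZMod.val_injective n h4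

/-- **The exponent homomorphism** `Gal(E/L) →* Multiplicative (Fin k → ZMod n)`,
`σ ↦ (aᵢ(σ))ᵢ`. [cite: Lang2002, VI §8] -/
def expntHom : (kummerField L y ≃ₐ[L] kummerField L y) →* Multiplicative (Fin k → ZMod n) where
  toFun σ := Multiplicative.ofAdd fun i => expnt hζ y c hc hy σ i
  map_one' := by
    -- `a(1) = 0`: `yᵢ = ζ^{a} yᵢ` forces `ζ^a = 1`
    have hn : 0 < n := Nat.pos_of_ne_zero (NeZero.ne n)
    have hζ' : IsPrimitiveRoot (algebraMap L Ω ζ) n :=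
      hζ.map_of_injective (algebraMap L Ω).injective
    change Multiplicative.ofAdd (fun i => expnt hζ y c hc hy 1 i) = Multiplicative.ofAdd 0
    congr 1
    funext i
    have h := algEquiv_apply_gen hζ y c hc hy 1 i
    rw [AlgEquiv.one_apply, coe_gen] at h
    have hyi : y i ≠ 0 := gen_ne_zero y c hc hy hn i
    have h' : algebraMap L Ω ζ ^ (expnt hζ y c hc hy 1 i).val = 1 := by
      have := h.symm
      rwa [mul_left_eq_self₀, or_iff_left hyi] at this
    rw [hζ'.pow_eq_one_iff_dvd] at h'
    have hlt := ZMod.val_lt (expnt hζ y c hc hy 1 i)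
    have h0 : (expnt hζ y c hc hy 1 i).val = 0 := Nat.eq_zero_of_dvd_of_lt h' hlt
    exact (ZMod.val_eq_zero _).1 h0
  map_mul' σ τ := by
    rw [← ofAdd_add]
    congr 1
    funext i
    exact expnt_mul hζ y c hc hy σ τ i

/-- Unfolding lemma for `expntHom`. [folklore] -/
theorem expntHom_apply (σ : kummerField L y ≃ₐ[L] kummerField L y) (i : Fin k) :
    (expntHom hζ y c hc hy σ).toAdd i = expnt hζ y c hc hy σ i := rfl

/-- **Injectivity**: an automorphism of `E = L(y₁, …, y_k)` is determined by its exponents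
(it is determined by its values on the generators). [cite: Lang2002, VI §8 (proof of Thm 8.1)] -/
theorem expntHom_injective : Function.Injective (expntHom hζ y c hc hy) := by
  intro σ τ h
  have hgen : ∀ i, σ (gen L y i) = τ (gen L y i) := fun i => by
    apply Subtype.ext
    rw [algEquiv_apply_gen hζ y c hc hy σ i, algEquiv_apply_gen hζ y c hc hy τ i,
      ← expntHom_apply hζ y c hc hy σ, ← expntHom_apply hζ y c hc hy τ, h]
  -- two `L`-algebra maps out of `adjoin L (range y)` agreeing on `range y` coincide
  have : (σ : kummerField L y →ₐ[L] kummerField L y) = τ := by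
    refine IntermediateField.adjoin_algHom_ext L ?_
    rintro _ ⟨i, rfl⟩
    exact hgen i
  exact AlgEquiv.coe_toAlgHom_injective this

/-! ### Bijectivity when `[E : L] = nᵏ` -/

/-- **The exponent homomorphism is bijective when `E/L` is Galois of degree `nᵏ`**
(injective, and both sides have `nᵏ` elements). [cite: Lang2002, VI §8 (Thm 8.1)] -/
theorem expntHom_bijective [IsGalois L (kummerField L y)]
    (hdeg : Module.finrank L (kummerField L y) = n ^ k) :
    Function.Bijective (expntHom hζ y c hc hy) := by
  classical
  have hn : 0 < n := Nat.pos_of_ne_zero (NeZero.ne n)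
  haveI : FiniteDimensional L (kummerField L y) :=
    Module.finite_of_finrank_pos (by rw [hdeg]; exact pow_pos hn k)
  rw [Nat.bijective_iff_injective_and_card]
  refine ⟨expntHom_injective hζ y c hc hy, ?_⟩
  rw [IsGalois.card_aut_eq_finrank, hdeg, Nat.card_eq_fintype_card]
  simp [ZMod.card]

/-! ### Kummer generators: elements with a power in `L` -/

/-- An additive map `(Fin k → ZMod n) → ZMod n` is `a ↦ ∑ aᵢ vᵢ` for `vᵢ` its values on the
standard basis. [folklore] -/
theorem addMonoidHom_pi_zmod_apply (f : (Fin k → ZMod n) →+ ZMod n) (a : Fin k → ZMod n) :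
    f a = ∑ i, a i * f (Pi.single i 1) := by
  classical
  conv_lhs => rw [show a = ∑ i, Pi.single i (a i) from (Finset.univ_sum_single a).symm]
  rw [map_sum]
  refine Finset.sum_congr rfl fun i _ => ?_
  have : Pi.single i (a i) = (a i).val • (Pi.single i (1 : ZMod n) : Fin k → ZMod n) := by
    rw [← Pi.single_smul, nsmul_eq_mul, ZMod.natCast_zmod_val, mul_one]
  rw [this, map_nsmul, nsmul_eq_mul, ZMod.natCast_zmod_val]

include hζ in
/-- For `σ ∈ Gal(E/L)` and `z ∈ E` with `zᵖ ∈ L`, `p ∣ n`: `σ(z) = ζ^b z` for some `b < n`.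
[cite: Lang2002, VI §8 (proof of Thm 8.2)] -/
theorem exists_expnt_of_pow_mem {p : ℕ} (hp : p ∣ n) {z : kummerField L y} {ℓ : L}
    (hz : (z : Ω) ^ p = algebraMap L Ω ℓ) (hz0 : z ≠ 0) (σ : kummerField L y ≃ₐ[L] kummerField L y) :
    ∃ b : ℕ, b < n ∧ (σ z : Ω) = algebraMap L Ω ζ ^ b * z := by
  have hz0' : (z : Ω) ≠ 0 := fun h => hz0 (Subtype.ext h)
  have h1 : ((σ z : kummerField L y) : Ω) ^ p = algebraMap L Ω ℓ := by
    have : z ^ p = algebraMap L (kummerField L y) ℓ := by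
      apply Subtype.ext
      simp only [SubmonoidClass.coe_pow, hz]
      rfl
    rw [← SubmonoidClass.coe_pow, ← map_pow, this, AlgEquiv.commutes]
    rfl
  set ξ : Ω := (σ z : Ω) * (z : Ω)⁻¹ with hξ
  have hξp : ξ ^ p = 1 := by
    rw [hξ, mul_pow, h1, ← hz, inv_pow, mul_inv_cancel₀ (pow_ne_zero _ hz0')]
  have hξn : ξ ^ n = 1 := by
    obtain ⟨m, rfl⟩ := hp
    rw [pow_mul, hξp, one_pow]
  have hζ' : IsPrimitiveRoot (algebraMap L Ω ζ) n := hζ.map_of_injective (algebraMap L Ω).injective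
  obtain ⟨b, hb, hbξ⟩ := hζ'.eq_pow_of_pow_eq_one hξn
  exact ⟨b, hb, by rw [hbξ, hξ, inv_mul_cancel_right₀ hz0']⟩

include hζ c hc hy in
/-- **Kummer generators lemma.** Let `E = L(y₁, …, y_k)` be Galois of degree `nᵏ` over `L`
(`L ∋ ζ` a primitive `n`-th root of unity, `yᵢⁿ = cᵢ ∈ Lˣ`). If `z ∈ E` is non-zero with
`zᵖ ∈ L` for some `p ∣ n`, then `z = ℓ · ∏ yᵢ^{vᵢ}` for some `ℓ ∈ L` and exponents `vᵢ`:
the character `σ ↦ σ(z)/z` of `Gal(E/L) ≅ (ℤ/n)ᵏ` is of the form `σ ↦ ζ^{∑ aᵢ(σ) vᵢ}`, so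
`z / ∏ yᵢ^{vᵢ}` is fixed by the Galois group. [cite: Lang2002, VI §8 (Thm 8.2)] -/
theorem exists_eq_mul_prod_pow [IsGalois L (kummerField L y)]
    (hdeg : Module.finrank L (kummerField L y) = n ^ k) {p : ℕ} (hp : p ∣ n)
    {z : kummerField L y} {ℓ : L} (hz : (z : Ω) ^ p = algebraMap L Ω ℓ) (hz0 : z ≠ 0) :
    ∃ (ℓ' : L) (v : Fin k → ℕ), (z : Ω) = algebraMap L Ω ℓ' * ∏ i, y i ^ v i := by
  classical
  have hn : 0 < n := Nat.pos_of_ne_zero (NeZero.ne n)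
  haveI : FiniteDimensional L (kummerField L y) :=
    Module.finite_of_finrank_pos (by rw [hdeg]; exact pow_pos hn k)
  have hζ' : IsPrimitiveRoot (algebraMap L Ω ζ) n := hζ.map_of_injective (algebraMap L Ω).injective
  have hz0' : (z : Ω) ≠ 0 := fun h => hz0 (Subtype.ext h)
  have hyi : ∀ i, y i ≠ 0 := gen_ne_zero y c hc hy hn
  -- the exponent `b(σ)` of `z`
  let bexp : (kummerField L y ≃ₐ[L] kummerField L y) → ZMod n := fun σ =>
    ((exists_expnt_of_pow_mem hζ y hp hz hz0 σ).choose : ZMod n)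
  have hb : ∀ σ, (σ z : Ω) = algebraMap L Ω ζ ^ (bexp σ).val * z := fun σ => by
    have h := (exists_expnt_of_pow_mem hζ y hp hz hz0 σ).choose_spec
    rw [show (bexp σ).val = _ from ZMod.val_natCast_of_lt h.1]
    exact h.2
  -- `b` is additive
  have hbmul : ∀ σ τ, bexp (σ * τ) = bexp σ + bexp τ := fun σ τ => by
    have h1 := hb (σ * τ)
    have h2 : ((σ * τ) z : Ω) = algebraMap L Ω ζ ^ (bexp σ).val * (algebraMap L Ω ζ ^ (bexp τ).val * z) := by
      rw [AlgEquiv.mul_apply]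
      have hτ : τ z = algebraMap L (kummerField L y) (ζ ^ (bexp τ).val) * z := by
        apply Subtype.ext
        rw [MulMemClass.coe_mul, hb τ, map_pow]
        rfl
      rw [hτ, map_mul, AlgEquiv.commutes, MulMemClass.coe_mul, hb σ, map_pow]
      change (algebraMap L Ω ζ) ^ _ * _ = _
      ring
    rw [h1, ← mul_assoc, ← zeta_pow_val_add hζ] at h2
    have h3 := mul_right_cancel₀ hz0' h2
    exact ZMod.val_injective n (hζ'.pow_inj (ZMod.val_lt _) (ZMod.val_lt _) h3)
  -- transport `b` to an additive map on `(Fin k → ZMod n)` through the bijection `expntHom`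
  have hbij := expntHom_bijective hζ y c hc hy hdeg
  let e := Equiv.ofBijective _ hbij
  let f : (Fin k → ZMod n) →+ ZMod n :=
    { toFun := fun a => bexp (e.symm (Multiplicative.ofAdd a))
      map_zero' := by
        have : e.symm (Multiplicative.ofAdd 0) = 1 :=
          e.symm_apply_eq.2 (map_one (expntHom hζ y c hc hy)).symm
        simp only [this]
        -- `b(1) = 0`
        have h := hb 1
        rw [AlgEquiv.one_apply] at h
        have h' : algebraMap L Ω ζ ^ (bexp 1).val = 1 := by
          have := h.symm
          rwa [mul_left_eq_self₀, or_iff_left hz0'] at this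
        rw [hζ'.pow_eq_one_iff_dvd] at h'
        exact (ZMod.val_eq_zero _).1 (Nat.eq_zero_of_dvd_of_lt h' (ZMod.val_lt _))
      map_add' := fun a a' => by
        have : e.symm (Multiplicative.ofAdd (a + a')) =
            e.symm (Multiplicative.ofAdd a) * e.symm (Multiplicative.ofAdd a') := by
          rw [Equiv.symm_apply_eq]
          change _ = expntHom hζ y c hc hy (_ * _)
          rw [map_mul]
          change _ = e (e.symm _) * e (e.symm _)
          rw [e.apply_symm_apply, e.apply_symm_apply]
          rfl
        simp only [this, hbmul] }
  set v : Fin k → ZMod n := fun i => f (Pi.single i 1) with hv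
  -- `b(σ) = ∑ aᵢ(σ) vᵢ`
  have hbsum : ∀ σ, bexp σ = ∑ i, expnt hζ y c hc hy σ i * v i := fun σ => by
    have h := addMonoidHom_pi_zmod_apply f (Multiplicative.toAdd (expntHom hζ y c hc hy σ))
    have hσ : e.symm (Multiplicative.ofAdd (Multiplicative.toAdd (expntHom hζ y c hc hy σ))) = σ := by
      rw [ofAdd_toAdd]; exact e.symm_apply_apply σ
    simp only [f, AddMonoidHom.coe_mk, ZeroHom.coe_mk, hσ] at h
    rw [h]
    rfl
  -- the candidate `w = z / ∏ yᵢ^{vᵢ}` is Galois-fixed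
  set P : kummerField L y := ∏ i, gen L y i ^ (v i).val with hP
  have hP0 : (P : Ω) ≠ 0 := by
    rw [hP]
    push_cast
    simp only [coe_gen]
    exact Finset.prod_ne_zero_iff.2 fun i _ => pow_ne_zero _ (hyi i)
  have hσP : ∀ σ : kummerField L y ≃ₐ[L] kummerField L y,
      (σ P : Ω) = algebraMap L Ω ζ ^ (∑ i, (expnt hζ y c hc hy σ i).val * (v i).val) * P := fun σ => by
    rw [hP, map_prod]
    push_cast
    simp only [map_pow, SubmonoidClass.coe_pow, algEquiv_apply_gen hζ y c hc hy σ, coe_gen,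
      mul_pow, Finset.prod_mul_distrib, ← pow_mul, Finset.prod_pow_eq_pow_sum]
  set w : kummerField L y := z * P⁻¹ with hw
  have hwfix : ∀ σ : kummerField L y ≃ₐ[L] kummerField L y, σ w = w := fun σ => by
    apply Subtype.ext
    have hPne : P ≠ 0 := fun h => hP0 (by rw [h]; rfl)
    rw [hw, map_mul, map_inv₀, MulMemClass.coe_mul, MulMemClass.coe_mul]
    rw [show ((σ P)⁻¹ : kummerField L y) = ((σ P : kummerField L y) : Ω)⁻¹ from rfl,
      show ((P⁻¹ : kummerField L y) : Ω) = (P : Ω)⁻¹ from rfl, hb σ, hσP σ]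
    -- exponents: `b σ ≡ ∑ aᵢ vᵢ (mod n)`
    have hexp : algebraMap L Ω ζ ^ (bexp σ).val =
        algebraMap L Ω ζ ^ (∑ i, (expnt hζ y c hc hy σ i).val * (v i).val) := by
      apply zeta_pow_eq_pow_of_modEq hζ
      rw [hbsum σ]
      have hcast : (∑ i, expnt hζ y c hc hy σ i * v i : ZMod n) =
          ((∑ i, (expnt hζ y c hc hy σ i).val * (v i).val : ℕ) : ZMod n) := by
        push_cast
        simp only [ZMod.natCast_zmod_val]
      rw [hcast, ZMod.val_natCast]
      exact Nat.mod_modEq _ _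
    rw [hexp]
    have hζne : algebraMap L Ω ζ ^ (∑ i, (expnt hζ y c hc hy σ i).val * (v i).val) ≠ 0 :=
      pow_ne_zero _ (hζ'.ne_zero (NeZero.ne n))
    field_simp
  -- hence `w ∈ L`
  have hwbot : (w : Ω) ∈ Set.range (algebraMap L Ω) := by
    have h1 : w ∈ (⊥ : IntermediateField L (kummerField L y)) :=
      (IsGalois.mem_bot_iff_fixed w).2 hwfix
    rw [IntermediateField.mem_bot] at h1
    obtain ⟨ℓ', hℓ'⟩ := h1
    refine ⟨ℓ', ?_⟩
    rw [← hℓ']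
    rfl
  obtain ⟨ℓ', hℓ'⟩ := hwbot
  refine ⟨ℓ', fun i => (v i).val, ?_⟩
  have hzw : (z : Ω) = (w : Ω) * P := by
    rw [hw, MulMemClass.coe_mul, show ((P⁻¹ : kummerField L y) : Ω) = (P : Ω)⁻¹ from rfl,
      inv_mul_cancel_right₀ hP0]
  rw [hzw, ← hℓ', hP]
  push_cast
  simp only [coe_gen]

/-! ### The Kummer field is Galois -/

include hζ hc hy in
/-- Every root of `Xⁿ − cⱼ` in `Ω` lies in `E` (it is `ζ^a yⱼ`). [folklore] -/
theorem mem_kummerField_of_pow_eq {r : Ω} {j : Fin k} (hr : r ^ n = algebraMap L Ω (c j)) :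
    r ∈ kummerField L y := by
  have hn : 0 < n := Nat.pos_of_ne_zero (NeZero.ne n)
  have hyj : y j ≠ 0 := gen_ne_zero y c hc hy hn j
  have hζ' : IsPrimitiveRoot (algebraMap L Ω ζ) n := hζ.map_of_injective (algebraMap L Ω).injective
  have h1 : (r * (y j)⁻¹) ^ n = 1 := by
    rw [mul_pow, hr, inv_pow, hy j, mul_inv_cancel₀]
    rw [← hy j]; exact pow_ne_zero _ hyj
  obtain ⟨a, -, ha⟩ := hζ'.eq_pow_of_pow_eq_one h1
  have : r = algebraMap L Ω (ζ ^ a) * y j := by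
    rw [map_pow, ha, inv_mul_cancel_right₀ hyj]
  rw [this]
  exact mul_mem ((kummerField L y).algebraMap_mem _) (IntermediateField.subset_adjoin L _ ⟨j, rfl⟩)

include hζ hc hy in
/-- **`E = L(y₁, …, y_k)` is Galois over `L`**: it is the splitting field of `∏ᵢ (Xⁿ − cᵢ)`
(all roots `ζ^a yᵢ` lie in `E`), and the generators are separable (`n ≠ 0` in `L`).
[cite: Lang2002, VI §8 (Thm 8.1)] -/
theorem isGalois_kummerField : IsGalois L (kummerField L y) := by
  classical
  have hn : 0 < n := Nat.pos_of_ne_zero (NeZero.ne n)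
  haveI : NeZero ((n : ℕ) : L) := hζ.neZero'
  have hnL : (n : L) ≠ 0 := NeZero.ne _
  have hζ' : IsPrimitiveRoot (algebraMap L Ω ζ) n := hζ.map_of_injective (algebraMap L Ω).injective
  -- the polynomial `∏ (Xⁿ - cᵢ)`
  set q : L[X] := ∏ i, (X ^ n - Polynomial.C (c i)) with hq
  have hq0 : q ≠ 0 := Finset.prod_ne_zero_iff.2 fun i _ => X_pow_sub_C_ne_zero hn (c i)
  have hsplit : (q.map (algebraMap L Ω)).Splits := by
    rw [hq, Polynomial.map_prod]
    refine Polynomial.Splits.prod fun i _ => ?_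
    rw [Polynomial.map_sub, Polynomial.map_pow, map_X, map_C]
    exact X_pow_sub_C_splits_of_isPrimitiveRoot hζ' (hy i)
  -- its root set generates `E`
  have hroots : IntermediateField.adjoin L (q.rootSet Ω) = kummerField L y := by
    apply le_antisymm
    · refine IntermediateField.adjoin_le_iff.2 fun r hr => ?_
      rw [Polynomial.mem_rootSet_of_ne hq0, hq, map_prod, Finset.prod_eq_zero_iff] at hr
      obtain ⟨j, -, hj⟩ := hr
      rw [map_sub, map_pow, Polynomial.aeval_X, Polynomial.aeval_C, sub_eq_zero] at hj
      exact mem_kummerField_of_pow_eq hζ y c hc hy hj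
    · refine IntermediateField.adjoin_le_iff.2 ?_
      rintro _ ⟨j, rfl⟩
      refine IntermediateField.subset_adjoin L _ ?_
      rw [Polynomial.mem_rootSet_of_ne hq0, hq, map_prod, Finset.prod_eq_zero_iff]
      exact ⟨j, Finset.mem_univ j, by
        rw [map_sub, map_pow, Polynomial.aeval_X, Polynomial.aeval_C, hy j, sub_self]⟩
  haveI : IsSplittingField L (kummerField L y) q := by
    rw [← hroots]; exact IntermediateField.adjoin_rootSet_isSplittingField hsplit
  haveI : Normal L (kummerField L y) := Normal.of_isSplittingField q
  haveI : Algebra.IsSeparable L (kummerField L y) := by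
    rw [IntermediateField.isSeparable_adjoin_iff_isSeparable]
    rintro _ ⟨j, rfl⟩
    -- `yⱼ` is a root of the separable polynomial `Xⁿ - cⱼ`
    have hsep : (X ^ n - Polynomial.C (c j)).Separable := separable_X_pow_sub_C (c j) hnL (hc j)
    have hint : IsIntegral L (y j) := by
      refine ⟨X ^ n - Polynomial.C (c j), monic_X_pow_sub_C _ hn.ne', ?_⟩
      rw [eval₂_sub, eval₂_X_pow, eval₂_C, hy j, sub_self]
    refine hsep.of_dvd (minpoly.dvd L (y j) ?_)
    rw [map_sub, map_pow, Polynomial.aeval_X, Polynomial.aeval_C, hy j, sub_self]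
  exact ⟨⟩

/-! ### Independence modulo `n`-th powers and the degree `nᵏ` -/

/-- **Independence of `c₁, …, c_k` modulo `n`-th powers in `L`**: if `∏ cᵢ^{vᵢ}` (`vᵢ ∈ ℤ`) is an
`n`-th power in `L` then `n ∣ vᵢ` for all `i` — the classes of the `cᵢ` in `Lˣ/Lˣⁿ` generate a
subgroup of order `nᵏ`. [cite: Lang2002, VI §8 (Thm 8.1)] -/
def IndepModPowers (n : ℕ) (c : Fin k → L) : Prop :=
  ∀ v : Fin k → ℤ, (∃ x : L, x ^ n = ∏ i, c i ^ v i) → ∀ i, (n : ℤ) ∣ v i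

include hy in
omit [NeZero n] in
/-- If a Laurent monomial `∏ yᵢ^{wᵢ}` lies in `L` then `n ∣ wᵢ` (raise to the `n`-th power and
use independence of the `cᵢ`). [cite: Lang2002, VI §8 (proof of Thm 8.1)] -/
theorem dvd_of_prod_zpow_mem (hH : IndepModPowers n c) (w : Fin k → ℤ) {ℓ : L}
    (hw : (∏ i, y i ^ w i) = algebraMap L Ω ℓ) : ∀ i, (n : ℤ) ∣ w i := by
  apply hH w ⟨ℓ, ?_⟩
  apply (algebraMap L Ω).injective
  rw [map_pow, ← hw, ← Finset.prod_pow, map_prod]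
  refine Finset.prod_congr rfl fun i _ => ?_
  rw [map_zpow₀, ← hy i, ← zpow_natCast, ← zpow_mul, ← zpow_natCast, ← zpow_mul, mul_comm]

omit [NeZero n] in
/-- Independence passes to the initial segment `c₁, …, c_k` of `c₁, …, c_{k+1}`. [folklore] -/
theorem IndepModPowers.init {k : ℕ} {c : Fin (k + 1) → L} (hH : IndepModPowers n c) :
    IndepModPowers n (fun i => c (Fin.castSucc i)) := by
  intro v ⟨x, hx⟩ i
  have h := hH (Fin.snoc v 0) ⟨x, ?_⟩ (Fin.castSucc i)
  · simpa using h
  · rw [hx, Fin.prod_univ_castSucc]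
    simp

/-- **The Kummer field has degree `nᵏ`** (Lang, *Algebra* VI §8, Thm 8.1, finite-rank case over a
field containing the `n`-th roots of unity and `√−1`): if `c₁, …, c_k ∈ Lˣ` are independent
modulo `n`-th powers then `[L(c₁^{1/n}, …, c_k^{1/n}) : L] = nᵏ`. Induction on `k`: the last step
`E' ⊂ E'(y_k)` has degree `n` because `Xⁿ − c_k` stays irreducible over `E' = L(y₁, …, y_{k-1})` —
were `c_k` a `p`-th power `bᵖ` in `E'` (`p ∣ n` prime), the Kummer generators lemma would give
`b = ℓ ∏ yᵢ^{vᵢ}`, whence a relation `c_k = ℓᵖ ∏ cᵢ^{uᵢ}` in `L` contradicting independence.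
[cite: Lang2002, VI §8 Thm 8.1] -/
theorem finrank_kummerField (hζ : IsPrimitiveRoot ζ n) (hi : ∃ i : L, i ^ 2 = -1) :
    ∀ (k : ℕ) (y : Fin k → Ω) (c : Fin k → L), (∀ i, c i ≠ 0) →
      (∀ i, y i ^ n = algebraMap L Ω (c i)) → IndepModPowers n c →
      Module.finrank L (kummerField L y) = n ^ k := by
  classical
  have hn : 0 < n := Nat.pos_of_ne_zero (NeZero.ne n)
  intro k
  induction k with
  | zero =>
    intro y c _ _ _
    have : kummerField L y = ⊥ := by
      rw [kummerField, Set.range_eq_empty y, IntermediateField.adjoin_empty]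
    rw [this, IntermediateField.finrank_bot, pow_zero]
  | succ k ih =>
    intro y c hc hy hH
    -- the initial segment
    set y' : Fin k → Ω := fun i => y (Fin.castSucc i) with hy'def
    set c' : Fin k → L := fun i => c (Fin.castSucc i) with hc'def
    have hc' : ∀ i, c' i ≠ 0 := fun i => hc _
    have hy' : ∀ i, y' i ^ n = algebraMap L Ω (c' i) := fun i => hy _
    have hH' : IndepModPowers n c' := hH.init
    have hdeg' := ih y' c' hc' hy' hH'
    haveI : IsGalois L (kummerField L y') := isGalois_kummerField hζ y' c' hc' hy'
    set E' : IntermediateField L Ω := kummerField L y' with hE'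
    haveI : FiniteDimensional L E' := Module.finite_of_finrank_pos (by rw [hdeg']; exact pow_pos hn k)
    set yk : Ω := y (Fin.last k) with hyk
    set ck : L := c (Fin.last k) with hck
    have hyk0 : yk ≠ 0 := gen_ne_zero y c hc hy hn (Fin.last k)
    -- `E = E'(y_k)`
    have hE : (IntermediateField.adjoin E' {yk}).restrictScalars L = kummerField L y := by
      rw [hE', IntermediateField.adjoin_adjoin_left, kummerField]
      congr 1
      ext r
      simp only [Set.mem_union, Set.mem_range, Set.mem_singleton_iff]
      constructor
      · rintro (⟨i, rfl⟩ | rfl)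
        · exact ⟨Fin.castSucc i, rfl⟩
        · exact ⟨Fin.last k, rfl⟩
      · rintro ⟨i, rfl⟩
        refine Fin.lastCases (Or.inr rfl) (fun j => Or.inl ⟨j, rfl⟩) i
    -- `Xⁿ - c_k` is irreducible over `E'`
    have hirr : Irreducible (X ^ n - Polynomial.C (algebraMap L E' ck)) := by
      obtain ⟨i, hi2⟩ := hi
      refine X_pow_sub_C_irreducible_of_isSquare_neg_one (NeZero.ne n)
        ⟨algebraMap L E' i, by rw [← map_pow, hi2, map_neg, map_one]⟩ ?_
      intro p hp hpn b hb
      have hb0 : b ≠ 0 := by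
        rintro rfl
        rw [zero_pow hp.ne_zero, eq_comm, map_eq_zero_iff _ (algebraMap L E').injective] at hb
        exact hc _ hb
      have hbΩ : ((b : Ω)) ^ p = algebraMap L Ω ck := by
        have := congrArg (fun x : E' => (x : Ω)) hb
        simpa using this
      obtain ⟨ℓ', v, hbv⟩ := exists_eq_mul_prod_pow hζ y' c' hc' hy' hdeg' hpn hbΩ hb0
      have hℓ'0 : ℓ' ≠ 0 := by
        rintro rfl
        rw [map_zero, zero_mul] at hbv
        exact hb0 (Subtype.ext hbv)
      -- `∏ y'ᵢ^{p vᵢ} = c_k / ℓ'ᵖ ∈ L`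
      have hℓΩ : algebraMap L Ω ℓ' ≠ 0 := (map_ne_zero_iff _ (algebraMap L Ω).injective).2 hℓ'0
      have hprod : (∏ i, y' i ^ ((p * v i : ℕ) : ℤ)) = algebraMap L Ω (ck * (ℓ' ^ p)⁻¹) := by
        have h1 : algebraMap L Ω ck = algebraMap L Ω ℓ' ^ p * ∏ i, y' i ^ (p * v i) := by
          rw [← hbΩ, hbv, mul_pow, ← Finset.prod_pow]
          simp_rw [← pow_mul, mul_comm (v _) p]
        rw [map_mul, map_inv₀, map_pow, h1]
        simp only [zpow_natCast]
        rw [mul_comm (algebraMap L Ω ℓ' ^ p), mul_assoc, mul_inv_cancel₀ (pow_ne_zero _ hℓΩ), mul_one]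
      have hdvd := dvd_of_prod_zpow_mem y' c' hy' hH' _ hprod
      -- write `p vᵢ = n uᵢ`
      choose u hu using hdvd
      have hu0 : ∀ i, 0 ≤ u i := fun i => by
        have h := hu i
        have : (0 : ℤ) ≤ (n : ℤ) * u i := by rw [← h]; positivity
        nlinarith [Int.natCast_pos.2 hn]
      -- `c_k = ℓ'ᵖ ∏ c'ᵢ^{uᵢ}` in `L`
      have hstar : ck = ℓ' ^ p * ∏ i, c' i ^ u i := by
        apply (algebraMap L Ω).injective
        have h2 : (∏ i, y' i ^ ((p * v i : ℕ) : ℤ)) = ∏ i, algebraMap L Ω (c' i) ^ u i := by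
          refine Finset.prod_congr rfl fun i _ => ?_
          rw [hu i, zpow_mul, zpow_natCast, hy' i]
        rw [map_mul, map_pow, map_prod]
        simp_rw [map_zpow₀]
        rw [← h2, hprod, map_mul, map_inv₀, map_pow, mul_comm (algebraMap L Ω ℓ' ^ p), mul_assoc,
          inv_mul_cancel₀ (pow_ne_zero _ hℓΩ), mul_one]
      -- contradiction with independence: exponent vector `(-m u, m)`, `m = n / p`
      obtain ⟨m, hm⟩ := hpn
      have hm0 : 0 < m := Nat.pos_of_ne_zero fun h => by rw [h, mul_zero] at hm; omega
      have key := hH (Fin.snoc (fun i => -((m : ℤ) * u i)) (m : ℤ)) ⟨ℓ', ?_⟩ (Fin.last k)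
      · rw [Fin.snoc_last] at key
        -- `n ∣ m` with `n = p m`, `p ≥ 2`: impossible
        have : (n : ℤ) ≤ m := Int.le_of_dvd (by exact_mod_cast hm0) key
        have hp2 := hp.two_le
        have : (n : ℤ) = p * m := by exact_mod_cast hm
        nlinarith
      · -- `ℓ'ⁿ = ∏ cᵢ ^ Vᵢ`
        rw [Fin.prod_univ_castSucc, Fin.snoc_last]
        simp only [Fin.snoc_castSucc]
        have hlast : c (Fin.last k) ^ (m : ℤ) = ℓ' ^ n * ∏ i, c (Fin.castSucc i) ^ ((m : ℤ) * u i) := by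
          rw [show c (Fin.last k) = ck from rfl, hstar, mul_zpow, zpow_natCast, ← pow_mul, hm,
            ← Finset.prod_zpow]
          congr 1
          refine Finset.prod_congr rfl fun i _ => ?_
          rw [← zpow_mul, mul_comm]
        rw [hlast, mul_left_comm, ← Finset.prod_mul_distrib, Finset.prod_eq_one, mul_one]
        intro i _
        rw [← zpow_add₀ (hc _), neg_add_cancel, zpow_zero]
    -- degree of the last step and the tower law
    have hint : IsIntegral E' yk := by
      refine ⟨X ^ n - Polynomial.C (algebraMap L E' ck), monic_X_pow_sub_C _ hn.ne', ?_⟩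
      rw [eval₂_sub, eval₂_X_pow, eval₂_C]
      change yk ^ n - algebraMap L Ω ck = 0
      rw [hyk, hck, hy, sub_self]
    have hmin : minpoly E' yk = X ^ n - Polynomial.C (algebraMap L E' ck) := by
      refine (minpoly.eq_of_irreducible_of_monic hirr ?_ (monic_X_pow_sub_C _ hn.ne')).symm
      rw [map_sub, map_pow, Polynomial.aeval_X, Polynomial.aeval_C]
      change yk ^ n - algebraMap L Ω ck = 0
      rw [hyk, hck, hy, sub_self]
    have htop : Module.finrank E' (IntermediateField.adjoin E' {yk}) = n := by
      rw [IntermediateField.adjoin.finrank hint, hmin, natDegree_X_pow_sub_C]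
    calc Module.finrank L (kummerField L y)
        = Module.finrank L ((IntermediateField.adjoin E' {yk}).restrictScalars L) := by rw [hE]
      _ = Module.finrank L (IntermediateField.adjoin E' {yk}) := rfl
      _ = Module.finrank L E' * Module.finrank E' (IntermediateField.adjoin E' {yk}) :=
          (Module.finrank_mul_finrank L E' _).symm
      _ = n ^ (k + 1) := by rw [hdeg', htop, pow_succ]

/-- **Converse: full degree forces independence.** If `[L(y) : L] = nᵏ` (`yᵢⁿ = cᵢ`) then the
`cᵢ` are independent modulo `n`-th powers: a relation `xⁿ = ∏ cᵢ^{vᵢ}` with `n ∤ v` gives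
`∏ yᵢ^{vᵢ} = ζ^a x ∈ L`, so the reduced monomial `∏ yᵢ^{vᵢ mod n}` is an `L`-multiple of `1`, and the
`nᵏ` reduced monomials, which span `L(y)`, are linearly dependent. [cite: Lang2002, VI §8 Thm 8.1] -/
theorem indepModPowers_of_finrank_eq (hζ : IsPrimitiveRoot ζ n) (hc : ∀ i, c i ≠ 0)
    (hy : ∀ i, y i ^ n = algebraMap L Ω (c i))
    (hdeg : Module.finrank L (kummerField L y) = n ^ k) : IndepModPowers n c := by
  classical
  have hn : 0 < n := Nat.pos_of_ne_zero (NeZero.ne n)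
  haveI : FiniteDimensional L (kummerField L y) :=
    Module.finite_of_finrank_pos (by rw [hdeg]; exact pow_pos hn k)
  have hζ' : IsPrimitiveRoot (algebraMap L Ω ζ) n := hζ.map_of_injective (algebraMap L Ω).injective
  have hyi : ∀ i, y i ≠ 0 := gen_ne_zero y c hc hy hn
  intro v ⟨x, hx⟩ i
  by_contra hndvd
  -- the reduced exponent vector `r = v mod n` is non-zero at `i`
  set r : Fin k → Fin n := fun j => ⟨(v j % n).toNat, by
    have h1 : 0 ≤ v j % n := Int.emod_nonneg _ (by exact_mod_cast hn.ne')
    have h2 : v j % n < n := Int.emod_lt_of_pos _ (by exact_mod_cast hn)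
    omega⟩ with hr
  have hri : r i ≠ ⟨0, hn⟩ := by
    intro h
    have h0 : (v i % n).toNat = 0 := by
      have := congrArg Fin.val h; simpa [hr] using this
    have h1 : 0 ≤ v i % n := Int.emod_nonneg _ (by exact_mod_cast hn.ne')
    have h2 : v i % n = 0 := by omega
    exact hndvd (Int.dvd_of_emod_eq_zero h2)
  -- `∏ yⱼ^{vⱼ} ∈ L`: it is an `n`-th root of `xⁿ`, hence `ζ^a x`
  have hx0 : x ≠ 0 := by
    rintro rfl
    rw [zero_pow hn.ne', eq_comm, Finset.prod_eq_zero_iff] at hx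
    obtain ⟨j, -, hj⟩ := hx
    exact hc j (zpow_eq_zero_iff (by
      intro h0; rw [h0, zpow_zero] at hj; exact one_ne_zero hj) |>.1 hj)
  have hprodL : ∃ ℓ : L, (∏ j, y j ^ v j) = algebraMap L Ω ℓ := by
    have h1 : ((∏ j, y j ^ v j) * (algebraMap L Ω x)⁻¹) ^ n = 1 := by
      have hprod : (∏ j, y j ^ v j) ^ n = ∏ j, algebraMap L Ω (c j) ^ v j := by
        rw [← Finset.prod_pow]
        refine Finset.prod_congr rfl fun j _ => ?_
        rw [← hy j, ← zpow_natCast (y j ^ v j) n, ← zpow_mul, mul_comm, zpow_mul, zpow_natCast]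
      have hxn : (algebraMap L Ω x) ^ n = ∏ j, algebraMap L Ω (c j) ^ v j := by
        rw [← map_pow, hx, map_prod]
        exact Finset.prod_congr rfl fun j _ => map_zpow₀ _ _ _
      have hne : (algebraMap L Ω x) ^ n ≠ 0 :=
        pow_ne_zero _ ((map_ne_zero_iff _ (algebraMap L Ω).injective).2 hx0)
      rw [mul_pow, inv_pow, hprod, ← hxn, mul_inv_cancel₀ hne]
    obtain ⟨a, -, ha⟩ := hζ'.eq_pow_of_pow_eq_one h1
    refine ⟨ζ ^ a * x, ?_⟩
    have hxΩ : algebraMap L Ω x ≠ 0 := (map_ne_zero_iff _ (algebraMap L Ω).injective).2 hx0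
    rw [map_mul, map_pow, ha, inv_mul_cancel_right₀ hxΩ]
  obtain ⟨ℓ, hℓ⟩ := hprodL
  -- the reduced monomial `∏ yⱼ^{rⱼ}` is an `L`-multiple of `1`
  have hred : ∃ ℓ' : L, (∏ j, y j ^ (r j : ℕ)) = algebraMap L Ω ℓ' := by
    -- `y^v = y^r · ∏ cⱼ^{vⱼ / n}`
    have h1 : (∏ j, y j ^ v j) = (∏ j, y j ^ (r j : ℕ)) * algebraMap L Ω (∏ j, c j ^ (v j / n)) := by
      rw [map_prod, ← Finset.prod_mul_distrib]
      refine Finset.prod_congr rfl fun j _ => ?_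
      rw [map_zpow₀, ← hy j,
        show (y j ^ n) ^ (v j / (n : ℤ)) = y j ^ ((n : ℤ) * (v j / n)) by
          rw [← zpow_natCast (y j) n, ← zpow_mul],
        show y j ^ ((r j : ℕ)) = y j ^ (((r j : ℕ) : ℤ)) from (zpow_natCast _ _).symm,
        ← zpow_add₀ (hyi j)]
      congr 1
      simp only [hr]
      have h0 : 0 ≤ v j % n := Int.emod_nonneg _ (by exact_mod_cast hn.ne')
      rw [Int.toNat_of_nonneg h0]
      exact (Int.emod_add_mul_ediv (v j) n).symm
    have hc0 : (∏ j, c j ^ (v j / n)) ≠ 0 := Finset.prod_ne_zero_iff.2 fun j _ => zpow_ne_zero _ (hc j)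
    refine ⟨ℓ * (∏ j, c j ^ (v j / n))⁻¹, ?_⟩
    rw [map_mul, map_inv₀, ← hℓ, h1, mul_assoc, mul_inv_cancel₀ ((map_ne_zero_iff _
      (algebraMap L Ω).injective).2 hc0), mul_one]
  obtain ⟨ℓ', hℓ'⟩ := hred
  -- linear dependence among the `nᵏ` spanning monomials `e ↦ ∏ yⱼ^{eⱼ}` of `E`
  let mono : (Fin k → Fin n) → kummerField L y := fun e => ∏ j, gen L y j ^ (e j : ℕ)
  have hspan : Submodule.span L (Set.range mono) = ⊤ := by
    -- image of the spanning family of the Kummer algebra under the surjection `aeval gen`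
    let φ : MvPolynomial (Fin k) L →ₐ[L] kummerField L y := MvPolynomial.aeval fun j => gen L y j
    have hφsurj : Function.Surjective φ := by
      rintro ⟨z, hz⟩
      have halg : ∀ w ∈ Set.range y, IsAlgebraic L w := by
        rintro _ ⟨j, rfl⟩
        refine ⟨X ^ n - Polynomial.C (c j), X_pow_sub_C_ne_zero hn _, ?_⟩
        rw [map_sub, map_pow, Polynomial.aeval_X, Polynomial.aeval_C, hy j, sub_self]
      have hz' : z ∈ (IntermediateField.adjoin L (Set.range y)).toSubalgebra := hz
      rw [IntermediateField.adjoin_toSubalgebra_of_isAlgebraic halg,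
        Algebra.adjoin_range_eq_range_aeval] at hz'
      obtain ⟨P, hP⟩ := hz'
      refine ⟨P, Subtype.ext ?_⟩
      change ((φ P : kummerField L y) : Ω) = z
      rw [← hP]
      change ((IsScalarTower.toAlgHom L (kummerField L y) Ω).comp φ) P = MvPolynomial.aeval y P
      rw [MvPolynomial.comp_aeval]
      rfl
    rw [eq_top_iff]
    rintro z -
    obtain ⟨P, rfl⟩ := hφsurj z
    induction P using MvPolynomial.induction_on' with
    | monomial d b =>
      have h1 : (MvPolynomial.monomial d b : MvPolynomial (Fin k) L) =
          b • ∏ j, MvPolynomial.X j ^ (d j) := by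
        rw [MvPolynomial.monomial_eq, MvPolynomial.smul_eq_C_mul, Finsupp.prod_fintype]
        intro j; rw [pow_zero]
      rw [h1, map_smul, map_prod]
      refine Submodule.smul_mem _ _ ?_
      have hφX : ∀ j, φ (MvPolynomial.X j ^ d j) = gen L y j ^ d j := fun j => by
        rw [map_pow]; exact congrArg (· ^ d j) (MvPolynomial.aeval_X _ j)
      simp only [hφX]
      -- reduce exponents: `gen j ^ d j = c j ^ (d j / n) • gen j ^ (d j % n)`
      have h2 : (∏ j, gen L y j ^ d j : kummerField L y) =
          (∏ j, c j ^ (d j / n)) • mono (fun j => ⟨d j % n, Nat.mod_lt _ hn⟩) := by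
        rw [Algebra.smul_def, map_prod, ← Finset.prod_mul_distrib]
        refine Finset.prod_congr rfl fun j _ => ?_
        have hgn : (gen L y j) ^ n = algebraMap L (kummerField L y) (c j) := by
          apply Subtype.ext; simp only [SubmonoidClass.coe_pow, coe_gen, hy j]; rfl
        conv_lhs => rw [← Nat.div_add_mod (d j) n, pow_add, pow_mul, hgn, ← map_pow]
      rw [h2]
      exact Submodule.smul_mem _ _ (Submodule.subset_span ⟨_, rfl⟩)
    | add p q hp hq =>
      rw [map_add]; exact Submodule.add_mem _ hp hq
  -- `mono r` is an `L`-multiple of `mono 0 = 1`, so `nᵏ - 1` of the monomials already span `E`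
  set z₀ : Fin k → Fin n := fun _ => ⟨0, hn⟩ with hz₀
  have hrz : r ≠ z₀ := fun h => hri (by rw [h])
  have h0 : mono z₀ = 1 := by simp [mono, hz₀]
  have hmr : mono r = ℓ' • mono z₀ := by
    rw [h0, Algebra.smul_def, mul_one]
    apply Subtype.ext
    simp only [mono, SubmonoidClass.coe_finsetProd, SubmonoidClass.coe_pow, coe_gen, hℓ']
    rfl
  have hle : Submodule.span L (Set.range mono) ≤
      Submodule.span L (mono '' {e | e ≠ r}) := by
    refine Submodule.span_le.2 ?_
    rintro _ ⟨e, rfl⟩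
    by_cases he : e = r
    · rw [he, hmr]
      exact Submodule.smul_mem _ _ (Submodule.subset_span ⟨z₀, hrz.symm, rfl⟩)
    · exact Submodule.subset_span ⟨e, he, rfl⟩
  have hcard : (mono '' {e | e ≠ r}).toFinset.card ≤ n ^ k - 1 := by
    have h1 : (mono '' {e | e ≠ r}).toFinset.card ≤ ({e | e ≠ r} : Set (Fin k → Fin n)).toFinset.card := by
      rw [Set.toFinset_image]
      exact Finset.card_image_le
    refine h1.trans ?_
    have h2 : ({e | e ≠ r} : Set (Fin k → Fin n)).toFinset = Finset.univ.erase r := by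
      ext e; simp
    rw [h2, Finset.card_erase_of_mem (Finset.mem_univ r), Finset.card_univ, Fintype.card_fun,
      Fintype.card_fin, Fintype.card_fin]
  have hfin : Module.finrank L (kummerField L y) ≤ n ^ k - 1 := by
    calc Module.finrank L (kummerField L y)
        = Module.finrank L (Submodule.span L (Set.range mono)) := by rw [hspan, finrank_top]
      _ ≤ Module.finrank L (Submodule.span L (mono '' {e | e ≠ r})) := Submodule.finrank_mono hle
      _ ≤ (mono '' {e | e ≠ r}).toFinset.card := finrank_span_le_card (R := L) _
      _ ≤ n ^ k - 1 := hcard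
  rw [hdeg] at hfin
  have : 1 ≤ n ^ k := Nat.one_le_pow _ _ hn
  omega

/-! ### The Kummer algebra `L[T] ⧸ (Tᵢⁿ − cᵢ)` is a field -/

section Maximal

variable {k : ℕ}

/-- The **Kummer ideal** `(T₁ⁿ − c₁, …, T_kⁿ − c_k) ⊆ L[T₁, …, T_k]`. [cite: Lang2002, VI §8] -/
def kummerIdeal (n : ℕ) (c : Fin k → L) : Ideal (MvPolynomial (Fin k) L) :=
  Ideal.span (Set.range fun i : Fin k => (MvPolynomial.X i ^ n - MvPolynomial.C (c i)))

/-- The generators lie in the Kummer ideal. [folklore] -/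
theorem X_pow_sub_C_mem_kummerIdeal (n : ℕ) (c : Fin k → L) (i : Fin k) :
    (MvPolynomial.X i ^ n - MvPolynomial.C (c i) : MvPolynomial (Fin k) L) ∈ kummerIdeal n c :=
  Ideal.subset_span ⟨i, rfl⟩

/-- In the Kummer algebra, `Tᵢ^e = cᵢ^{e / n} Tᵢ^{e % n}`. [folklore] -/
theorem mk_X_pow_eq (n : ℕ) (c : Fin k → L) (i : Fin k) (e : ℕ) :
    Ideal.Quotient.mk (kummerIdeal n c) (MvPolynomial.X i ^ e) =
      Ideal.Quotient.mk (kummerIdeal n c) (MvPolynomial.C (c i ^ (e / n)) * MvPolynomial.X i ^ (e % n)) := by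
  have hXn : Ideal.Quotient.mk (kummerIdeal n c) (MvPolynomial.X i ^ n) =
      Ideal.Quotient.mk (kummerIdeal n c) (MvPolynomial.C (c i)) := by
    rw [Ideal.Quotient.eq]
    exact X_pow_sub_C_mem_kummerIdeal n c i
  conv_lhs => rw [← Nat.div_add_mod e n, pow_add, pow_mul]
  rw [map_mul, map_pow, hXn, ← map_pow, ← map_mul, ← map_pow]

/-- The class of the reduced monomial `∏ Tᵢ^{eᵢ}` (`eᵢ < n`) in the Kummer algebra. [folklore] -/
def reducedMonomial (n : ℕ) (c : Fin k → L) (e : Fin k → Fin n) :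
    MvPolynomial (Fin k) L ⧸ kummerIdeal n c :=
  Ideal.Quotient.mkₐ L (kummerIdeal n c) (∏ i, MvPolynomial.X i ^ (e i : ℕ))

/-- **The reduced monomials span the Kummer algebra**: the classes of the `nᵏ` monomials
`∏ Tᵢ^{eᵢ}`, `eᵢ < n`, span `L[T] ⧸ (Tᵢⁿ − cᵢ)` as an `L`-vector space.
[cite: Lang2002, VI §8 (proof of Thm 8.1)] -/
theorem span_reducedMonomial_eq_top (n : ℕ) [NeZero n] (c : Fin k → L) :
    Submodule.span L (Set.range (reducedMonomial n c)) = ⊤ := by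
  classical
  have hn : 0 < n := Nat.pos_of_ne_zero (NeZero.ne n)
  set mk := Ideal.Quotient.mkₐ L (kummerIdeal n c) with hmk
  have hmk' : ∀ x, mk x = Ideal.Quotient.mk (kummerIdeal n c) x := fun x => rfl
  -- reduction of a monomial: `∏ Xᵢ^{dᵢ} ≡ (∏ cᵢ^{dᵢ/n}) • ∏ Xᵢ^{dᵢ % n}`
  have hred : ∀ d : Fin k → ℕ, mk (∏ i, MvPolynomial.X i ^ d i) =
      (∏ i, c i ^ (d i / n)) • reducedMonomial n c (fun i => ⟨d i % n, Nat.mod_lt _ hn⟩) := fun d => by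
    have h : mk (∏ i, MvPolynomial.X i ^ d i) =
        mk (MvPolynomial.C (∏ i, c i ^ (d i / n)) * ∏ i, MvPolynomial.X i ^ (d i % n)) := by
      rw [hmk', hmk', map_prod, Finset.prod_congr rfl (fun i _ => mk_X_pow_eq n c i (d i)), ← map_prod,
        Finset.prod_mul_distrib, map_prod MvPolynomial.C]
    rw [h, ← MvPolynomial.smul_eq_C_mul, map_smul]
    rfl
  rw [eq_top_iff]
  rintro x -
  obtain ⟨P, rfl⟩ := Ideal.Quotient.mkₐ_surjective L (kummerIdeal n c) x
  induction P using MvPolynomial.induction_on' with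
  | monomial d a =>
    have h1 : (MvPolynomial.monomial d a : MvPolynomial (Fin k) L) =
        a • ∏ i, MvPolynomial.X i ^ (d i) := by
      rw [MvPolynomial.monomial_eq, MvPolynomial.smul_eq_C_mul, Finsupp.prod_fintype]
      intro i; rw [pow_zero]
    rw [h1, map_smul, ← hmk, hred]
    exact Submodule.smul_mem _ _ (Submodule.smul_mem _ _ (Submodule.subset_span ⟨_, rfl⟩))
  | add p q hp hq =>
    rw [map_add]
    exact Submodule.add_mem _ hp hq

/-- The Kummer algebra is finite-dimensional over `L`. [folklore] -/
theorem finite_quotient_kummerIdeal (n : ℕ) [NeZero n] (c : Fin k → L) :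
    Module.Finite L (MvPolynomial (Fin k) L ⧸ kummerIdeal n c) := by
  classical
  refine ⟨⟨(Set.range (reducedMonomial n c)).toFinset, ?_⟩⟩
  rw [Set.coe_toFinset, span_reducedMonomial_eq_top]

/-- The Kummer algebra has dimension at most `nᵏ`. [cite: Lang2002, VI §8 (proof of Thm 8.1)] -/
theorem finrank_quotient_kummerIdeal_le (n : ℕ) [NeZero n] (c : Fin k → L) :
    Module.finrank L (MvPolynomial (Fin k) L ⧸ kummerIdeal n c) ≤ n ^ k := by
  classical
  calc Module.finrank L (MvPolynomial (Fin k) L ⧸ kummerIdeal n c)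
      = Module.finrank L (Submodule.span L (Set.range (reducedMonomial n c))) := by
        rw [span_reducedMonomial_eq_top, finrank_top]
    _ ≤ (Set.range (reducedMonomial n c)).toFinset.card :=
        finrank_span_le_card (R := L) (Set.range (reducedMonomial n c))
    _ ≤ Fintype.card (Fin k → Fin n) := by
        rw [Set.toFinset_range]; exact Finset.card_image_le.trans (by simp)
    _ = n ^ k := by simp

/-- **Kummer theory of finite rank: the Kummer algebra is a field** (Lang, *Algebra* VI §8,
Thm 8.1/8.2 — the form "`L[T₁, …, T_k] ⧸ (Tᵢⁿ − cᵢ) ≅ L(c₁^{1/n}, …, c_k^{1/n})` is a field of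
degree `nᵏ`"): over a field `L` containing a primitive `n`-th root of unity and `√−1`, if
`c₁, …, c_k ∈ Lˣ` are independent modulo `n`-th powers, then the ideal `(T₁ⁿ − c₁, …, T_kⁿ − c_k)`
of `L[T₁, …, T_k]` is maximal. (Choose `n`-th roots `yᵢ` of the `cᵢ` in an algebraic closure; the
evaluation `T ↦ y` maps `L[T]/(Tⁿ − c)`, of dimension `≤ nᵏ`, onto `L(y)` of dimension `nᵏ`
(`finrank_kummerField`), hence is an isomorphism onto a field.) Consequently any two `k`-tuples of
`n`-th roots of `c` (in any extensions of `L`) satisfy the same polynomial relations over `L`.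
[cite: Lang2002, VI §8 Thm 8.1] -/
theorem isMaximal_kummerIdeal {n : ℕ} [NeZero n] {ζ : L} (hζ : IsPrimitiveRoot ζ n)
    (hi : ∃ i : L, i ^ 2 = -1) (c : Fin k → L) (hc : ∀ i, c i ≠ 0) (hH : IndepModPowers n c) :
    (kummerIdeal n c).IsMaximal := by
  classical
  have hn : 0 < n := Nat.pos_of_ne_zero (NeZero.ne n)
  -- roots in an algebraic closure
  let Ω := AlgebraicClosure L
  have hroot : ∀ i, ∃ z : Ω, z ^ n = algebraMap L Ω (c i) := fun i =>
    IsAlgClosed.exists_pow_nat_eq _ hn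
  choose y hy using hroot
  set E := kummerField L y with hE
  have hdeg : Module.finrank L E = n ^ k := finrank_kummerField hζ hi k y c hc hy hH
  haveI : FiniteDimensional L E := Module.finite_of_finrank_pos (by rw [hdeg]; exact pow_pos hn k)
  -- evaluation at the generators
  let φ : MvPolynomial (Fin k) L →ₐ[L] E := MvPolynomial.aeval fun i => gen L y i
  have hφsurj : Function.Surjective φ := by
    rintro ⟨x, hx⟩
    have halg : ∀ z ∈ Set.range y, IsAlgebraic L z := by
      rintro _ ⟨i, rfl⟩
      refine ⟨X ^ n - Polynomial.C (c i), X_pow_sub_C_ne_zero hn _, ?_⟩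
      rw [map_sub, map_pow, Polynomial.aeval_X, Polynomial.aeval_C, hy i, sub_self]
    have hx' : x ∈ (IntermediateField.adjoin L (Set.range y)).toSubalgebra := hx
    rw [IntermediateField.adjoin_toSubalgebra_of_isAlgebraic halg, Algebra.adjoin_range_eq_range_aeval] at hx'
    obtain ⟨P, hP⟩ := hx'
    refine ⟨P, Subtype.ext ?_⟩
    change ((φ P : E) : Ω) = x
    rw [← hP]
    change ((IsScalarTower.toAlgHom L E Ω).comp φ) P = MvPolynomial.aeval y P
    rw [MvPolynomial.comp_aeval]
    rfl
  -- `kummerIdeal ≤ ker φ`, and `ker φ` is maximal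
  have hle : kummerIdeal n c ≤ RingHom.ker φ := by
    refine Ideal.span_le.2 ?_
    rintro _ ⟨i, rfl⟩
    rw [SetLike.mem_coe, RingHom.mem_ker, map_sub, map_pow, MvPolynomial.aeval_X, MvPolynomial.aeval_C]
    apply Subtype.ext
    change (y i) ^ n - algebraMap L Ω (c i) = 0
    rw [hy i, sub_self]
  have hmax : (RingHom.ker φ).IsMaximal := RingHom.ker_isMaximal_of_surjective φ hφsurj
  -- dimension count: the surjection `L[T]/kummerIdeal → L[T]/ker φ ≅ E` is injective
  suffices heq : kummerIdeal n c = RingHom.ker φ by rw [heq]; exact hmax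
  refine le_antisymm hle ?_
  -- `Ideal.Quotient.factor` as an `L`-linear surjection between spaces of dimension `≤ nᵏ` and `= nᵏ`
  let ψ : (MvPolynomial (Fin k) L ⧸ kummerIdeal n c) →ₐ[L] E :=
    Ideal.Quotient.liftₐ (kummerIdeal n c) φ fun a ha => hle ha
  have hψsurj : Function.Surjective ψ := by
    intro e
    obtain ⟨P, rfl⟩ := hφsurj e
    exact ⟨Ideal.Quotient.mk _ P, rfl⟩
  have hψinj : Function.Injective ψ := by
    -- a surjective linear map from a space of dimension ≤ nᵏ onto one of dimension nᵏ
    have h1 := finrank_quotient_kummerIdeal_le n c (L := L)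
    haveI : FiniteDimensional L (MvPolynomial (Fin k) L ⧸ kummerIdeal n c) :=
      finite_quotient_kummerIdeal n c
    have h2 : Module.finrank L E ≤ Module.finrank L (MvPolynomial (Fin k) L ⧸ kummerIdeal n c) :=
      LinearMap.finrank_le_finrank_of_surjective (f := ψ.toLinearMap) hψsurj
    have h3 : Module.finrank L (MvPolynomial (Fin k) L ⧸ kummerIdeal n c) = Module.finrank L E :=
      le_antisymm (h1.trans hdeg.symm.le) h2
    exact (LinearMap.injective_iff_surjective_of_finrank_eq_finrank h3 (f := ψ.toLinearMap)).2 hψsurj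
  intro a ha
  rw [RingHom.mem_ker] at ha
  have : ψ (Ideal.Quotient.mk _ a) = 0 := by
    change Ideal.Quotient.lift (kummerIdeal n c) (φ : MvPolynomial (Fin k) L →+* E) _ (Ideal.Quotient.mk _ a) = 0
    rw [Ideal.Quotient.lift_mk]; exact ha
  rw [← map_zero ψ] at this
  have h0 := hψinj this
  exact Ideal.Quotient.eq_zero_iff_mem.1 h0

end Maximal

end Literature.FieldTheory.Kummer
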